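import Literature.RepresentationTheory.KonnoKonno2007.JunctionVacuumTwist
import Literature.RepresentationTheory.KonnoKonno2007.JunctionSwapSymmetry
import Literature.RepresentationTheory.KonnoKonno2007.JunctionVacuumExponents
import HarnessLib

/-!
# The determinant characters of the real unitary dual-pair junction (kernel, 0 records)

The tree file `JunctionVacuumTwist` proves that the exponent family of a junction datum is closed under
twisting by continuous unitary characters `χ_V^m`, `χ_W^{m′}` of `G_∞` restricting on the maximal compact to
`(det a · det b)^m`, `(det c · det d)^{m′}` (`RealDualPairJunction.FockVacuumCharacter.of_sub_eq_sub`) — WITH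
those characters as hypotheses ("an instance supplies them").  This file SUPPLIES them for the concrete
junction `RealDualPair.junction P Q R S` (`G_∞ = U(P,Q) × U(R,S)` as matrices): `|det g| = 1` on `U(P,Q)`
(`norm_det_UForm`, from `ḡᵀ J g = J`, `det J ≠ 0`), the continuous unitary characters
`detVChar m = det(g_V)^m`, `detWChar m′ = det(g_W)^{m′}` (`Ginf P Q R S →* Circle`), their values on
`κ(K_V × K_W)`, and the hypothesis-free corollary `FockVacuumCharacter.of_sub_eq_sub_junction`: over the
concrete junction EVERY exponent tuple with the same two differences as a realised one is realised; with
the two zero-point pins (`RealDualPair.eP_sub_eQ` of `RealUnitaryDualPairSL2`, `RealDualPair.eR_sub_eS` of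
`JunctionSwapSymmetry`) this gives the COMPLETE description `fockVacuumCharacter_junction_iff`: over a junction
with all four blocks nonempty and one realised tuple, `f` is realised iff `f_P − f_Q = |R| − |S|` and
`f_R − f_S = |P| − |Q|` — the exponent family is exactly this affine plane (differences pinned, sums free: the
integer avatar of Konno–Konno's twisting parameters `m, m′`, §4.1 p. 49).  In particular NO absolute exponent
is decided by the datum notion — that is record-level.  §5 makes this explicit for definite `W` (`S = ∅`):
`e_S` is invisible (`vacScalar_eS_of_isEmpty`, `FockVacuumCharacter.eS_irrel`), the family is
`{f : f_P − f_Q = |R|}` (`fockVacuumCharacter_junction_iff_of_isEmpty_right`; `R = ∅`: `…_of_isEmpty_left`,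
`f_P − f_Q = −|S|`), and at the cell's own pair
`U(2,1) × U(1)` (currency `DPIdx (Fin 2) Unit Unit Empty`) **`fockVacuumCharacter_ι₁_iff_of_realised`**:
given one realised `e`, `f` is realised iff `f_P − f_Q = 1` — the `U(W) = U(1)` vacuum weight `f_R` is FREE.
§6 restates §4–§5 in DATUM FORM (via `RealDualPairJunction.exists_fockVacuumCharacter` of
`JunctionVacuumExponents`): for EVERY archimedean Weil datum `ω` over the concrete junction the same `iff`s hold
(`fockVacuumCharacter_junction_iff_of_datum`, `…_of_datum_of_isEmpty_right`, **`fockVacuumCharacter_ι₁_iff`**).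

BOUNDARY.  Kernel only ([folklore] linear algebra); no statement of print is used; no record is introduced or
modified.

## References (conventions only)
* [KonnoKonno2007] §3.1 (3.1), §3.3 p. 47, §4.1 p. 49 (the twisting parameters `m, m′`), Lemma 5.2 p. 73.
* [Folland1989] Ch. 4 §2 (4.23).
-/

set_option autoImplicit false

noncomputable section

open Complex Matrix MeasureTheory SchwartzMap
open Literature.Analysis.SegalBargmann Literature.RepresentationTheory.HeisenbergGroup
open Literature.NumberTheory.Weil1964
open Literature.NumberTheory.Automorphic Literature.NumberTheory.Automorphic.UnitaryGroup

namespace Literature.RepresentationTheory.KonnoKonno2007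

namespace RealDualPair

/-! ## 1. `|det g| = 1` on `U(P,Q)` -/

section UForm

variable {P Q : Type*} [Fintype P] [DecidableEq P] [Fintype Q] [DecidableEq Q]

/-- `det J ≠ 0` for the sign form `J = diag(1_P, −1_Q)`. [folklore] -/
theorem det_signForm_ne_zero : (signForm P Q).det ≠ 0 := by
  rw [Matrix.det_fromBlocks_zero₂₁, Matrix.det_one, one_mul]
  simp [Matrix.det_neg, Matrix.det_one]

/-- **`|det g| = 1` on `U(P,Q)`**: from `ḡᵀ J g = J` and `det J ≠ 0` (the compact analogue for
`Matrix.unitaryGroup` is the tree's `norm_det_unitaryGroup` in `FockModelUnitaryDualPair`). [folklore] -/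
theorem norm_det_UForm (g : UForm P Q) : ‖(((g : GL (P ⊕ Q) ℂ) : Matrix (P ⊕ Q) (P ⊕ Q) ℂ)).det‖ = 1 := by
  set M : Matrix (P ⊕ Q) (P ⊕ Q) ℂ := ((g : GL (P ⊕ Q) ℂ) : Matrix (P ⊕ Q) (P ⊕ Q) ℂ) with hM
  have hg : (M.map (starRingEnd ℂ))ᵀ * signForm P Q * M = signForm P Q := g.2
  have hdet := congrArg Matrix.det hg
  rw [Matrix.det_mul, Matrix.det_mul, Matrix.det_transpose] at hdet
  have hmap : (M.map (starRingEnd ℂ)).det = starRingEnd ℂ M.det := by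
    rw [← RingHom.mapMatrix_apply, RingHom.map_det]
  rw [hmap] at hdet
  have h1 : starRingEnd ℂ M.det * M.det = 1 := by
    have h' : starRingEnd ℂ M.det * (signForm P Q).det * M.det =
        (starRingEnd ℂ M.det * M.det) * (signForm P Q).det := by ring
    rw [h'] at hdet
    exact (mul_eq_right₀ det_signForm_ne_zero).mp hdet
  have h2 := congrArg (‖·‖) h1
  simp only [norm_mul, Complex.norm_conj, norm_one] at h2
  nlinarith [norm_nonneg M.det]

/-- `det g ≠ 0` on `U(P,Q)`. [folklore] -/
theorem det_UForm_ne_zero (g : UForm P Q) : (((g : GL (P ⊕ Q) ℂ) : Matrix (P ⊕ Q) (P ⊕ Q) ℂ)).det ≠ 0 := by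
  intro h
  have h1 := norm_det_UForm g
  rw [h, norm_zero] at h1
  exact zero_ne_one h1

/-- `g ↦ det g` is continuous on `U(P,Q)`. [folklore] -/
theorem continuous_det_UForm :
    Continuous fun g : UForm P Q => (((g : GL (P ⊕ Q) ℂ) : Matrix (P ⊕ Q) (P ⊕ Q) ℂ)).det :=
  (continuous_id.matrix_det).comp (Units.continuous_val.comp continuous_subtype_val)

end UForm

/-! ## 2. The determinant characters `det(g_V)^m`, `det(g_W)^{m′}` of `G_∞ = U(P,Q) × U(R,S)` -/

variable {P Q R S : Type*} [Fintype P] [DecidableEq P] [Fintype Q] [DecidableEq Q]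
  [Fintype R] [DecidableEq R] [Fintype S] [DecidableEq S]

variable (P Q R S)

/-- **The `V`-determinant character** `χ_V^m : (g_V, g_W) ↦ det(g_V)^m ∈ S¹`. [folklore] -/
def detVChar (m : ℤ) : Ginf P Q R S →* Circle where
  toFun g := ⟨(((g.1 : GL (P ⊕ Q) ℂ) : Matrix (P ⊕ Q) (P ⊕ Q) ℂ)).det ^ m,
    mem_sphere_zero_iff_norm.2 (by rw [norm_zpow, norm_det_UForm, _root_.one_zpow])⟩
  map_one' := Circle.ext (by simp)
  map_mul' g h := Circle.ext (by
    simp only [Prod.fst_mul, Subgroup.coe_mul, Units.val_mul, Matrix.det_mul, mul_zpow, Circle.coe_mul])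

/-- **The `W`-determinant character** `χ_W^{m′} : (g_V, g_W) ↦ det(g_W)^{m′} ∈ S¹`. [folklore] -/
def detWChar (m' : ℤ) : Ginf P Q R S →* Circle where
  toFun g := ⟨(((g.2 : GL (R ⊕ S) ℂ) : Matrix (R ⊕ S) (R ⊕ S) ℂ)).det ^ m',
    mem_sphere_zero_iff_norm.2 (by rw [norm_zpow, norm_det_UForm, _root_.one_zpow])⟩
  map_one' := Circle.ext (by simp)
  map_mul' g h := Circle.ext (by
    simp only [Prod.snd_mul, Subgroup.coe_mul, Units.val_mul, Matrix.det_mul, mul_zpow, Circle.coe_mul])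

variable {P Q R S}

/-- unfolding. [folklore] -/
@[simp] theorem coe_detVChar (m : ℤ) (g : Ginf P Q R S) :
    ((detVChar P Q R S m g : Circle) : ℂ) = (((g.1 : GL (P ⊕ Q) ℂ) : Matrix (P ⊕ Q) (P ⊕ Q) ℂ)).det ^ m := rfl

/-- unfolding. [folklore] -/
@[simp] theorem coe_detWChar (m' : ℤ) (g : Ginf P Q R S) :
    ((detWChar P Q R S m' g : Circle) : ℂ) = (((g.2 : GL (R ⊕ S) ℂ) : Matrix (R ⊕ S) (R ⊕ S) ℂ)).det ^ m' := rfl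

/-- `χ_V^m` is continuous. [folklore] -/
theorem continuous_detVChar (m : ℤ) : Continuous (detVChar P Q R S m) := by
  refine Continuous.subtype_mk ?_ _
  exact (continuous_det_UForm.comp continuous_fst).zpow₀ m fun g => Or.inl (det_UForm_ne_zero g.1)

/-- `χ_W^{m′}` is continuous. [folklore] -/
theorem continuous_detWChar (m' : ℤ) : Continuous (detWChar P Q R S m') := by
  refine Continuous.subtype_mk ?_ _
  exact (continuous_det_UForm.comp continuous_snd).zpow₀ m' fun g => Or.inl (det_UForm_ne_zero g.2)

/-- on the maximal compact: `χ_V^m (κ k) = (det a · det b)^m`. [folklore] -/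
theorem detVChar_κ (m : ℤ) (k : DPK P Q R S) :
    ((detVChar P Q R S m (κ P Q R S k) : Circle) : ℂ) =
      ((k.1.1 : Matrix P P ℂ).det * (k.1.2 : Matrix Q Q ℂ).det) ^ m := by
  rw [coe_detVChar, coe_κ_fst, Matrix.det_fromBlocks_zero₂₁]

/-- on the maximal compact: `χ_W^{m′} (κ k) = (det c · det d)^{m′}`. [folklore] -/
theorem detWChar_κ (m' : ℤ) (k : DPK P Q R S) :
    ((detWChar P Q R S m' (κ P Q R S k) : Circle) : ℂ) =
      ((k.2.1 : Matrix R R ℂ).det * (k.2.2 : Matrix S S ℂ).det) ^ m' := by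
  rw [coe_detWChar, coe_κ_snd, Matrix.det_fromBlocks_zero₂₁]

/-! ## 3. The exponent family of the concrete junction: sums are free -/

/-- **Every tuple with the same differences is realised over the concrete junction** (the tree's
`FockVacuumCharacter.of_sub_eq_sub` with its character hypotheses discharged by `detVChar`, `detWChar`).
[folklore] -/
theorem _root_.Literature.RepresentationTheory.KonnoKonno2007.RealDualPairJunction.FockVacuumCharacter.of_sub_eq_sub_junction
    {e : VacExponents} (h : (junction P Q R S).FockVacuumCharacter e) (f : VacExponents)
    (hPQ : f.eP - e.eP = f.eQ - e.eQ) (hRS : f.eR - e.eR = f.eS - e.eS) :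
    (junction P Q R S).FockVacuumCharacter f :=
  h.of_sub_eq_sub (detVChar P Q R S) (detWChar P Q R S) (continuous_detVChar) (continuous_detWChar)
    (fun m k => by rw [junction_κ, detVChar_κ]) (fun m' k => by rw [junction_κ, detWChar_κ]) f hPQ hRS

/-- **The affine plane through a realised tuple**: `e + (m, m, m′, m′)` is realised for all `m, m′`. [folklore] -/
theorem _root_.Literature.RepresentationTheory.KonnoKonno2007.RealDualPairJunction.FockVacuumCharacter.add_junction
    {e : VacExponents} (h : (junction P Q R S).FockVacuumCharacter e) (m m' : ℤ) :
    (junction P Q R S).FockVacuumCharacter ⟨e.eP + m, e.eQ + m, e.eR + m', e.eS + m'⟩ :=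
  h.of_sub_eq_sub_junction _ (by simp) (by simp)

/-! ## 4. The complete description: differences pinned, sums free -/

/-- **The exponent family of the concrete junction is an affine plane**: given one realised tuple and all
four blocks nonempty, `f` is realised iff `f_P − f_Q = |R| − |S|` and `f_R − f_S = |P| − |Q|`
(pins: `eP_sub_eQ`, `eR_sub_eS`; freedom: `of_sub_eq_sub_junction`). [folklore] -/
theorem fockVacuumCharacter_junction_iff {e : VacExponents} (h : (junction P Q R S).FockVacuumCharacter e)
    (p₀ : P) (q₀ : Q) (r₀ : R) (s₀ : S) (f : VacExponents) :
    (junction P Q R S).FockVacuumCharacter f ↔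
      (f.eP - f.eQ = (Fintype.card R : ℤ) - Fintype.card S ∧
        f.eR - f.eS = (Fintype.card P : ℤ) - Fintype.card Q) := by
  refine ⟨fun hf => ⟨eP_sub_eQ hf p₀ q₀, eR_sub_eS hf r₀ s₀⟩, fun hf => ?_⟩
  have h1 := eP_sub_eQ h p₀ q₀
  have h2 := eR_sub_eS h r₀ s₀
  exact h.of_sub_eq_sub_junction f (by linarith [hf.1]) (by linarith [hf.2])

/-! ## 5. Definite `W` (one `W`-block empty): both `W`-exponents are free -/

/-- with `S` empty the exponent `e_S` is invisible in the vacuum scalar (`det` of an empty matrix is `1`).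
[folklore] -/
theorem vacScalar_eS_of_isEmpty [IsEmpty S] (e : VacExponents) (d : ℤ) (k : DPK P Q R S) :
    vacScalar (⟨e.eP, e.eQ, e.eR, d⟩ : VacExponents) k = vacScalar e k := by
  simp only [vacScalar, Matrix.det_isEmpty, _root_.one_zpow]

/-- with `S` empty the record does not see `e_S`. [folklore] -/
theorem _root_.Literature.RepresentationTheory.KonnoKonno2007.RealDualPairJunction.FockVacuumCharacter.eS_irrel
    [IsEmpty S] {Ginf : Type*} [Group Ginf] [TopologicalSpace Ginf] {D : RealDualPairJunction P Q R S Ginf}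
    {e : VacExponents} (h : D.FockVacuumCharacter e) (d : ℤ) :
    D.FockVacuumCharacter ⟨e.eP, e.eQ, e.eR, d⟩ := by
  obtain ⟨ω, hW, hvac⟩ := h
  exact ⟨ω, hW, fun k => by rw [vacScalar_eS_of_isEmpty e d k]; exact hvac k⟩

/-- **Definite `W` on the right (`S = ∅`)**: given one realised tuple, `f` is realised iff
`f_P − f_Q = |R|`; BOTH `W`-exponents are free — `e_S` is invisible and `e_R` (the `U(W)`-weight of the
vacuum) moves under the twist `χ_W^{m′} = det(g_W)^{m′}`. [folklore] -/
theorem fockVacuumCharacter_junction_iff_of_isEmpty_right [IsEmpty S] {e : VacExponents}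
    (h : (junction P Q R S).FockVacuumCharacter e) (p₀ : P) (q₀ : Q) (f : VacExponents) :
    (junction P Q R S).FockVacuumCharacter f ↔ f.eP - f.eQ = Fintype.card R := by
  have hS : (Fintype.card S : ℤ) = 0 := by simp
  refine ⟨fun hf => by simpa [hS] using eP_sub_eQ hf p₀ q₀, fun hf => ?_⟩
  have h1 := eP_sub_eQ h p₀ q₀
  obtain ⟨fP, fQ, fR, fS⟩ := f
  dsimp only at hf
  have h2 : (junction P Q R S).FockVacuumCharacter ⟨fP, fQ, fR, e.eS + (fR - e.eR)⟩ :=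
    h.of_sub_eq_sub_junction ⟨fP, fQ, fR, e.eS + (fR - e.eR)⟩ (by dsimp only; linarith) (by dsimp only; ring)
  exact h2.eS_irrel fS

/-- with `R` empty the exponent `e_R` is invisible in the vacuum scalar. [folklore] -/
theorem vacScalar_eR_of_isEmpty [IsEmpty R] (e : VacExponents) (c : ℤ) (k : DPK P Q R S) :
    vacScalar (⟨e.eP, e.eQ, c, e.eS⟩ : VacExponents) k = vacScalar e k := by
  simp only [vacScalar, Matrix.det_isEmpty, _root_.one_zpow]

/-- with `R` empty the record does not see `e_R`. [folklore] -/
theorem _root_.Literature.RepresentationTheory.KonnoKonno2007.RealDualPairJunction.FockVacuumCharacter.eR_irrel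
    [IsEmpty R] {Ginf : Type*} [Group Ginf] [TopologicalSpace Ginf] {D : RealDualPairJunction P Q R S Ginf}
    {e : VacExponents} (h : D.FockVacuumCharacter e) (c : ℤ) :
    D.FockVacuumCharacter ⟨e.eP, e.eQ, c, e.eS⟩ := by
  obtain ⟨ω, hW, hvac⟩ := h
  exact ⟨ω, hW, fun k => by rw [vacScalar_eR_of_isEmpty e c k]; exact hvac k⟩

/-- **Definite `W` on the left (`R = ∅`)**: given one realised tuple, `f` is realised iff `f_P − f_Q = −|S|`;
both `W`-exponents are free. [folklore] -/
theorem fockVacuumCharacter_junction_iff_of_isEmpty_left [IsEmpty R] {e : VacExponents}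
    (h : (junction P Q R S).FockVacuumCharacter e) (p₀ : P) (q₀ : Q) (f : VacExponents) :
    (junction P Q R S).FockVacuumCharacter f ↔ f.eP - f.eQ = -(Fintype.card S : ℤ) := by
  have hR : (Fintype.card R : ℤ) = 0 := by simp
  refine ⟨fun hf => by simpa [hR] using eP_sub_eQ hf p₀ q₀, fun hf => ?_⟩
  have h1 := eP_sub_eQ h p₀ q₀
  obtain ⟨fP, fQ, fR, fS⟩ := f
  dsimp only at hf
  have h2 : (junction P Q R S).FockVacuumCharacter ⟨fP, fQ, e.eR + (fS - e.eS), fS⟩ :=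
    h.of_sub_eq_sub_junction ⟨fP, fQ, e.eR + (fS - e.eS), fS⟩ (by dsimp only; linarith) (by dsimp only; ring)
  exact h2.eR_irrel fR

/-- **At the cell's pair `U(2,1) × U(1)`** (currency `DPIdx (Fin 2) Unit Unit Empty`): given one realised `e`,
`f` is realised iff `f_P − f_Q = 1`; the `U(W) = U(1)` vacuum weight `f_R` is FREE — no absolute `W`-exponent is
decided by the datum notion. [folklore] -/
theorem fockVacuumCharacter_ι₁_iff_of_realised {e : VacExponents}
    (h : (junction (Fin 2) Unit Unit Empty).FockVacuumCharacter e) (f : VacExponents) :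
    (junction (Fin 2) Unit Unit Empty).FockVacuumCharacter f ↔ f.eP - f.eQ = 1 := by
  simpa using fockVacuumCharacter_junction_iff_of_isEmpty_right h 0 () f


/-! ## 6. Datum form: the same descriptions from ANY archimedean Weil datum over the junction -/

/-- **datum form of `fockVacuumCharacter_junction_iff`**: for every archimedean Weil datum `ω` over the
concrete junction (all four blocks nonempty), `f` is realised iff its two differences are the zero-point
values `|R| − |S|`, `|P| − |Q|`. [folklore] -/
theorem fockVacuumCharacter_junction_iff_of_datum
    {ω : Representation ℂ (Ginf P Q R S) (SchwartzMap (DPIdx P Q R S → ℝ) ℂ)}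
    (hW : IsArchWeilDatum (junction P Q R S).ι𝕎 ω) (p₀ : P) (q₀ : Q) (r₀ : R) (s₀ : S) (f : VacExponents) :
    (junction P Q R S).FockVacuumCharacter f ↔
      (f.eP - f.eQ = (Fintype.card R : ℤ) - Fintype.card S ∧
        f.eR - f.eS = (Fintype.card P : ℤ) - Fintype.card Q) := by
  obtain ⟨e, he⟩ := (junction P Q R S).exists_fockVacuumCharacter hW
  exact fockVacuumCharacter_junction_iff he p₀ q₀ r₀ s₀ f

/-- datum form, definite `W` (`S = ∅`): `f` is realised iff `f_P − f_Q = |R|`; `f_R`, `f_S` free. [folklore] -/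
theorem fockVacuumCharacter_junction_iff_of_datum_of_isEmpty_right [IsEmpty S]
    {ω : Representation ℂ (Ginf P Q R S) (SchwartzMap (DPIdx P Q R S → ℝ) ℂ)}
    (hW : IsArchWeilDatum (junction P Q R S).ι𝕎 ω) (p₀ : P) (q₀ : Q) (f : VacExponents) :
    (junction P Q R S).FockVacuumCharacter f ↔ f.eP - f.eQ = Fintype.card R := by
  obtain ⟨e, he⟩ := (junction P Q R S).exists_fockVacuumCharacter hW
  exact fockVacuumCharacter_junction_iff_of_isEmpty_right he p₀ q₀ f

/-- **The cell's pair `U(2,1) × U(1)`, datum form**: for every archimedean Weil datum `ω` over the `ι₁`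
junction (currency `DPIdx (Fin 2) Unit Unit Empty`), `f` is realised iff `f_P − f_Q = 1`; the `U(W) = U(1)`
vacuum weight `f_R` is free — no absolute `W`-weight is decided by the datum notion. [folklore] -/
theorem fockVacuumCharacter_ι₁_iff
    {ω : Representation ℂ (Ginf (Fin 2) Unit Unit Empty) (SchwartzMap (DPIdx (Fin 2) Unit Unit Empty → ℝ) ℂ)}
    (hW : IsArchWeilDatum (junction (Fin 2) Unit Unit Empty).ι𝕎 ω) (f : VacExponents) :
    (junction (Fin 2) Unit Unit Empty).FockVacuumCharacter f ↔ f.eP - f.eQ = 1 := by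
  obtain ⟨e, he⟩ := (junction (Fin 2) Unit Unit Empty).exists_fockVacuumCharacter hW
  exact fockVacuumCharacter_ι₁_iff_of_realised he f

end RealDualPair

end Literature.RepresentationTheory.KonnoKonno2007

end
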